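import Literature.MathematicalPhysics.QuantumFieldTheory.Balaban1983to89.B8JunctionH59Vacuity
import Literature.MathematicalPhysics.QuantumFieldTheory.Balaban1983to89.B8IdxB8LawsB

/-!
# `Balaban1983to89.B8SockB9P3LawsBinderVacuity` — KERNEL CERTIFICATE (consequence of the located corner defect): the «b9 socket AT EVERY LAW MEMBER,
# all levels» binder `SB9all` of the N05 knits keyed on the bond-law class (`∀ i : ZdIdx d L, IdxB8LawsB L i → ∀ m ≤ i.k, SockB9P3 … i.η m i.Ω i.Λs i.Λb`,
# files `Summits/…/BalabanUVNodesN05SubBKnit*.lean`, `…N05SubBHKnit*.lean`, `…N05AtRecord1{2,3}SubB*.lean`) is UNSATISFIABLE (`d ≥ 2`, `L ≥ 1`, `B₀ > 0`,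
# `cP > 0`) — the law class CONTAINS Proposition 6's finite-`□₀` cube family (`exists_member_cube_lawsB`), at which the all-levels socket is refuted

statement-level skeleton of published theorems with citation tags; proofs where landed; nothing here is a claim about the
Yang–Mills mass gap

`[Balaban1985RegularSpaces]` ("B8", CMP **99** (1985) 75–102) (1.58)–(1.59) p. 86, Thm 4 p. 88, Prop. 6 p. 99, (1.130)–(1.131) pp. 98–99, p. 77
(«we admit Ω_j = T_η»); [4] = `[Balaban1985BackgroundPropagators]` Thm 3.3 p. 398.  PDF held: `paper:balaban1985-cmp99-regular-spaces-gauge-fixing`.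

CITATION HEADER (lean-in-tree rule).  Cell `pub-ymgap` (YM Track A, HUMAN RULING D-0062), DAG node N05 = [B8], seat `pub-ymgap-dag-n05-d` (g6).  Sixth
certificate of the located typing defect «(1.59) socket in the `SideTouches` currency at a FINITE `Ω₀`» (dag-n05-e's `CORNER-DEFECT-H59.md`; certificates
`B8SockH59CornerDefect`, `B8SockH59NotAtCube`, `B8JunctionH59Vacuity`, `B8SockB9P3CubeBinderVacuity`).  BY NAME: the Proposition-6 cube family
`(cubeFam false L a M ρ k, cubeLamS …, cubeLamB …)` at `a = 0, M = 0, ρ = L, k = 1, η = L⁻¹` IS a member of `ZdIdx d L` obeying the FOUR index laws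
(`B8IdxB8LawsB.exists_member_cube_lawsB`, dag-n05-c g2), so the law-keyed binder instantiates to the all-levels socket at the cube member, refuted by
`B8JunctionH59Vacuity.not_sockB9P3_allLevels_cubeMember` (dag-n05-e g5).  ★ `not_sockB9P3_lawsBinder` (generic) and ★ `sB9all_lawsBinder_false` (the EXACT
`SB9all` display of the knits, `θ : Stage3Params`, `lam : ResidB8 θ`: from it and the knits' own `hD : 2 ≤ θ.D`, `hcB9 : 0 < cB9` follows `False`).
CONSEQUENCE (count-neutral): every N05 knit ∕ face of this lineage keyed that way (p467769 … p514768, p515416 and their ₁₂∕₁₃ faces) has an unsatisfiable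
hypothesis set AS TYPED; the repair is the RE-KEYING to the `Ω₀ = ℤᵈ` law members (print p. 77; `CORNER-DEFECT-H59.md` (R-b′)) —
`Summits/…/BalabanUVNodesN05SubBHKnitUniv.lean` (this seat), where the cube member is excluded (`B8IdxB8LawsB.not_exists_idxB8SubB_cubeMember`) and no
kernel refutation applies.

HONEST SCOPE.  By-name composition into a negative typing certificate; nothing of [4] ∕ [Balaban1985RegularSpaces] proved or refuted (print consistent:
Theorem 4's socket lives at `Ω₀ = T`); N05 NOT discharged; SECOND-GAP: none; one finite `T⁴` programme at fixed `ε`, Bałaban as printed; nothing continuum ∕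
ℝ⁴ ∕ OS ∕ mass-gap ∕ Clay.  No `sorry`, no `def`, no `instance`, no `notation`.  Unit `pub-ymgap-dag-n05-d` (g6), 2026-08-27.
-/

noncomputable section

namespace Literature.MathematicalPhysics.QuantumFieldTheory.Balaban1983to89.B8SockB9P3LawsBinderVacuity

open NormedSpace
open B7Prop1Explicit B7Prop2Explicit
open B8LeafModelZd (ZdIdx)
open B8LeafModelZd3 (SockB9P3)
open B8IdxB8LawsB (IdxB8LawsB exists_member_cube_lawsB)
open B8Eq131CubesAdmissible (cubeFam)
open B8CubeMemberZd (cubeLamS cubeLamB)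
open B8JunctionH59Vacuity (not_sockB9P3_allLevels_cubeMember)
open Node00 (Stage3Params ResidB8)

export B7Prop1Explicit (Site)

variable {d : ℕ} {𝔸 : Type*} [CStarAlgebra 𝔸] [Nontrivial 𝔸]

/-- ★ **THE «b9 SOCKET AT EVERY LAW MEMBER, ALL LEVELS» BINDER IS UNSATISFIABLE** (`d ≥ 2`, `L ≥ 1`, `B₀ > 0`, `cP > 0`; any `B₀β, β, len`): the
hypothesis `SB9all` of the N05 knits keyed on `IdxB8LawsB` WITHOUT the `Ω₀ = ℤᵈ` clause.  Witness member: Proposition 6's cube family at `a = 0, M = 0, ρ = L,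
k = 1, η = L⁻¹` (`exists_member_cube_lawsB`), where the socket is `not_sockB9P3_allLevels_cubeMember`'s.
[cite: Balaban1985RegularSpaces, (1.58)–(1.59) p.86, Thm 4 p.88, (1.130)–(1.131) pp.98–99, p.77; Balaban1985BackgroundPropagators, Thm 3.3 p.398] -/
theorem not_sockB9P3_lawsBinder (hd2 : 2 ≤ d) {L : ℕ} (hL : 1 ≤ L) {B₀ B₀β cP β : ℝ} {len : Site d → ℝ} (hB₀ : 0 < B₀) (hcP : 0 < cP) :
    ¬ (∀ i : ZdIdx d L, IdxB8LawsB L i → ∀ m, m ≤ i.k → SockB9P3 (𝔸 := 𝔸) L B₀ B₀β cP β len i.η m i.Ω i.Λs i.Λb) := by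
  intro H
  have hL0 : (0 : ℝ) < L := by exact_mod_cast hL
  have hη : (0 : ℝ) < (L : ℝ)⁻¹ := by positivity
  have hscale : (L : ℝ) ^ 1 * (L : ℝ)⁻¹ ≤ 1 := by rw [pow_one, mul_inv_cancel₀ hL0.ne']
  obtain ⟨i, hk, hiη, hΩ, hΛ, hΛb, hlaws⟩ := exists_member_cube_lawsB (d := d) hL (0 : Site d) 0 (le_refl L) (le_refl 1) hη hscale
  have h := H i hlaws
  rw [hk, hiη, hΩ, hΛ, hΛb] at h
  exact not_sockB9P3_allLevels_cubeMember hd2 hL hη (0 : Site d) 0 (le_refl L) (le_refl 1) hB₀ hcP h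

/-- ★ **THE KNITS' OWN `SB9all` DISPLAY YIELDS `False`** — the EXACT binder text of `Summits/…/BalabanUVNodesN05SubBHKnit(T8E)` ∕ `…SubBKnit*` (θ-keyed:
`θ : Stage3Params`, `lam : ResidB8 θ`, constant `cB9`) together with those theorems' own hypotheses `hD : 2 ≤ θ.D`, `hcB9 : 0 < cB9` (and `θ.L ≥ 2`,
`lam.inp.B₀ > 0`, which the record supplies) is contradictory: their hypothesis sets are unsatisfiable AS TYPED.
[cite: Balaban1985RegularSpaces, (1.58)–(1.59) p.86, Thm 4 p.88, (1.131) p.99, p.77; Balaban1985BackgroundPropagators, Thm 3.3 p.398] -/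
theorem sB9all_lawsBinder_false {θ : Stage3Params} (lam : ResidB8 θ) (hD : 2 ≤ θ.D) {cB9 : ℝ} (hcB9 : 0 < cB9)
    (SB9all : ∀ i : ZdIdx θ.D θ.L, IdxB8LawsB θ.L i → ∀ m, m ≤ i.k →
      SockB9P3 (𝔸 := θ.𝔸) θ.L lam.inp.B₀ lam.B₀β cB9 lam.β lam.len i.η m i.Ω i.Λs i.Λb) : False :=
  not_sockB9P3_lawsBinder (𝔸 := θ.𝔸) hD (le_trans (by norm_num) θ.two_le_L) lam.inp.B₀_pos hcB9 SB9all

#print axioms not_sockB9P3_lawsBinder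
#print axioms sB9all_lawsBinder_false

end Literature.MathematicalPhysics.QuantumFieldTheory.Balaban1983to89.B8SockB9P3LawsBinderVacuity

end
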